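import Summits.QuantumFields.BalabanUV.T4Continuum.Support.ScalarCovariantCTDefects
import Summits.QuantumFields.BalabanUV.T4Continuum.Support.ScalarCovariantCTWeighted
import Summits.QuantumFields.BalabanUV.T4Continuum.Support.CovariantBlockAveraging

/-!
# T⁴ programme, SUBSTRATE (shared lattice-gauge analysis library) — THE COVARIANT GRADIENT `D_R` AGAINST THE COMBES–THOMAS RESCALING: entries,
# the bond weight, the commutator `Ecomm` (`e^{κρ_b}·(D_Rx) = D_R(e^{κρ}x) + Ecomm(e^{κρ}x)`) and its LEVEL-FREE size `‖Ecomm‖ ≤ 2√d·card o·(1 + α)·κ`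
# (file B of the gradient half of the decay chain)

Substrate cell `b2b-balaban-substrate-*`, seat p3; gradient half of the chain «level-free decay of the covariant scalar averaged Green function»
(`ScalarCovariantCoercive` p217284 → `ScalarCovariantCTDefects` → `ScalarCovariantGreenDecay`; then `ScalarCovariantCTWeighted` → `ScalarCovariantGradComm`
→ `ScalarCovariantGreenGradDecay`).  Files 1–3 give, for `S_U = scalarOp n M a′ R T = D_RᴴD_R + a′n^dQ′(U)ᴴQ′(U)` on `Tor (fine n M) × o`, the
coercivity `γ_U = gammaU d a′ α τ`, the level-free row-defect budget `Jcov` and the decay of the ENTRIES of `S_U⁻¹` ([B9] =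
[Balaban1985BackgroundPropagators] Thm 3.1 (3.42) p.397, FIRST entry, ℓ²-pairing shadow).  The rows also consume the DERIVATIVE entries
«|(∇_UG′(U)λ)(x)|, |(G′(U)∇*_Uλ)(x)| ≤ B₀(L^jη)e^{−δ₀d(y,y′)}|λ|» (same display; NE3's reading `hT31` item 1 is open even at `U = 1` — header of
`Support/SliceFlatGaugeDecay`); the gradient half proves their level-free ℓ²-pairing shadows for the one-region model.

THIS FILE (the covariant gradient `D_R = GaugeTermDecomposition.covGrad (fine n M) n R` on colour 0-forms):
 * `injM_kron_mul_apply`, **`covGrad_apply`**: `D_R(((x,ν),α),(x′,α′)) = n·(R_ν(x)_{αα′}[x′ = x + e_ν] − [x′ = x][α = α′])`;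
 * the bond weight **`bondW ρ₀ ((x,ν),α) = ρ₀ x`** (a bond carries the weight of its base site), the commutator **`Ecomm κ ρ₀ R`**
   (`Ecomm(b, e′) = D_R(b, e′)·(e^{κ(ρ_b − ρ_{e′})} − 1)`) and the identity **`wvec_covGrad_mulVec`**;
 * `abs_exp_sub_one_le_of_small` (`|e^t − 1| ≤ 2κ/n` for `|t| ≤ κ/n`, `κ ≤ 1`), `norm_Ecomm_apply_le` (entries `≤ 2(1+α)κ`, supported on
   `e′ = (x + e_ν, ·)`), and by the rectangular Schur test (`CovariantBlockAveraging.opNorm_le_sqrt_of_schur`) the LEVEL-FREE size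
   **`opNorm_Ecomm_le`**: `‖Ecomm‖ ≤ 2√d·card o·(1 + α)·κ` for `0 ≤ κ ≤ 1`, `ρ₀` `1/n`-Lipschitz along fine bonds, `‖n(R − 1)‖ ≤ α`, `2 ≤ n·M_μ`.

HONEST FRAMING (T4-DAG p. 1).  MODEL level: one region, global small field, ℓ²-pairing ∕ entry norms (no sup∕Hölder norms, no second
derivatives `Δ_UG′`), route = Combes–Thomas (OURS); constants OURS and crude.  NOT [B9] Thm 3.1 as printed; nothing printed is a hypothesis;
no `def … : Prop` fact; spine 0/9 unchanged; NOT infinite volume ∕ mass gap ∕ Clay.  HONEST DEPENDENCY: continuum YM on T⁴ ⇐ BetaPertH ∧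
nine spine estimates (0/9 proved); BetaPertH ⇐ (D1) ∧ (D4) ∧ CAP+tail; G-an2-4 gates asym, D1 and NE2/3/4.  ABSOLUTE RULE kept; no `sorry`.
-/

noncomputable section

open scoped BigOperators ComplexConjugate Matrix Matrix.Norms.L2Operator Kronecker ComplexOrder

namespace Summit.QuantumFields.BalabanUV.T4Continuum.ScalarCovariantGradComm

open Literature.MathematicalPhysics.QuantumFieldTheory.Balaban1983to89.B5Prop11Plancherel (Tor fine unitVec)
open Literature.MathematicalPhysics.QuantumFieldTheory.Balaban1983to89.B5Action121 (shiftS)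
open Literature.MathematicalPhysics.QuantumFieldTheory.Balaban1983to89.B5Prop11Lower (nsq nsq_nonneg)
open Summit.QuantumFields.BalabanUV.T4Continuum
open Summit.QuantumFields.BalabanUV.T4Continuum.KroneckerLift
open Summit.QuantumFields.BalabanUV.T4Continuum.BlockMultiplication
open Summit.QuantumFields.BalabanUV.T4Continuum.KroneckerUnits (norm_entry_le)
open Summit.QuantumFields.BalabanUV.T4Continuum.GaugeTermDecomposition
open Summit.QuantumFields.BalabanUV.T4Continuum.ScalarCovariantLaplacian
open Summit.QuantumFields.BalabanUV.T4Continuum.CovariantBlockAveraging (opNorm_le_sqrt_of_schur)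
open Summit.QuantumFields.BalabanUV.T4Continuum.ScalarCovariantCoercive (siteW)
open Summit.QuantumFields.BalabanUV.T4Continuum.ScalarCovariantCTDefects (siteMul_shift_apply norm_R_le)
open Summit.QuantumFields.BalabanUV.T4Continuum.ScalarCovariantCTWeighted (wvec)

section Gradient

variable {d : ℕ} {o : Type*} [Fintype o] [DecidableEq o]
variable (n : ℕ) [NeZero n] (M : Fin d → ℕ) [hM : ∀ μ, NeZero (M μ)]

/-- `((injM_μ ⊗ 1)·X)(((x,ν),α), e′) = [ν = μ]·X((x,α), e′)`. [folklore] -/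
theorem injM_kron_mul_apply {σ : Type*} (μ : Fin d) (X : Matrix (Tor (fine n M) × o) σ ℂ) (b : (Tor (fine n M) × Fin d) × o) (e' : σ) :
    (injM (fine n M) μ ⊗ₖ (1 : Matrix o o ℂ) * X) b e' = if b.1.2 = μ then X (b.1.1, b.2) e' else 0 := by
  rw [Matrix.mul_apply, Fintype.sum_prod_type, Finset.sum_eq_single b.1.1]
  · rw [Finset.sum_eq_single b.2]
    · rw [Matrix.kroneckerMap_apply, Matrix.one_apply_eq, mul_one, injM]
      by_cases h : b.1.2 = μ
      · rw [if_pos h, if_pos (by rw [← h])]; simp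
      · rw [if_neg h, if_neg (fun h' => h (by rw [Prod.ext_iff] at h'; exact h'.2)), zero_mul]
    · intro β _ hβ
      rw [Matrix.kroneckerMap_apply, Matrix.one_apply_ne (Ne.symm hβ), mul_zero, zero_mul]
    · intro h; exact absurd (Finset.mem_univ _) h
  · intro y _ hy
    refine Finset.sum_eq_zero fun β _ => ?_
    rw [Matrix.kroneckerMap_apply, injM, if_neg (fun h' => hy (by rw [Prod.ext_iff] at h'; exact h'.1.symm)), zero_mul, zero_mul]
  · intro h; exact absurd (Finset.mem_univ _) h

/-- **the entries of the covariant gradient**: `D_R(((x,ν),α),(x′,α′)) = n·(R_ν(x)_{αα′}[x′ = x + e_ν] − [x′ = x][α = α′])`. [folklore] -/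
theorem covGrad_apply (R : Fin d → (Tor (fine n M) → Matrix o o ℂ)) (b : (Tor (fine n M) × Fin d) × o) (e' : Tor (fine n M) × o) :
    covGrad (fine n M) ((n : ℕ) : ℂ) R b e'
      = ((n : ℕ) : ℂ) * ((if e'.1 = b.1.1 + unitVec (fine n M) b.1.2 then R b.1.2 b.1.1 b.2 e'.2 else 0)
          - (if e' = (b.1.1, b.2) then 1 else 0)) := by
  rw [covGrad_eq_sum_scovD, Matrix.sum_apply, Finset.sum_eq_single b.1.2]
  · rw [injM_kron_mul_apply, if_pos rfl, scovD, Matrix.smul_apply, smul_eq_mul, Matrix.sub_apply, siteMul_shift_apply, Matrix.one_apply]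
    congr 2
    by_cases h : (b.1.1, b.2) = e'
    · rw [if_pos h, if_pos h.symm]
    · rw [if_neg h, if_neg (Ne.symm h)]
  · intro μ _ hμ; rw [injM_kron_mul_apply, if_neg (Ne.symm hμ)]
  · intro h; exact absurd (Finset.mem_univ _) h

/-- the bond weight: a bond `((x,ν),α)` carries the weight of its base site `x`. [folklore] -/
abbrev bondW (ρ₀ : Tor (fine n M) → ℝ) : (Tor (fine n M) × Fin d) × o → ℝ := fun b => ρ₀ b.1.1

/-- **the commutator of `D_R` with the rescaling**: `Ecomm(b, e′) = D_R(b, e′)·(e^{κ(ρ_b − ρ_{e′})} − 1)` (vanishes on the diagonal part,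
lives on the nearest-neighbour part). [folklore] -/
def Ecomm (κ : ℝ) (ρ₀ : Tor (fine n M) → ℝ) (R : Fin d → (Tor (fine n M) → Matrix o o ℂ)) :
    Matrix ((Tor (fine n M) × Fin d) × o) (Tor (fine n M) × o) ℂ :=
  Matrix.of fun b e' => covGrad (fine n M) ((n : ℕ) : ℂ) R b e' * ((Real.exp (κ * (ρ₀ b.1.1 - ρ₀ e'.1)) - 1 : ℝ) : ℂ)

/-- **`e^{κρ_b}·(D_Rx) = D_R(e^{κρ}x) + Ecomm(e^{κρ}x)`**. [folklore] -/
theorem wvec_covGrad_mulVec (κ : ℝ) (ρ₀ : Tor (fine n M) → ℝ) (R : Fin d → (Tor (fine n M) → Matrix o o ℂ)) (x : Tor (fine n M) × o → ℂ) :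
    wvec κ (bondW n M ρ₀) (covGrad (fine n M) ((n : ℕ) : ℂ) R *ᵥ x)
      = covGrad (fine n M) ((n : ℕ) : ℂ) R *ᵥ wvec κ (siteW n M ρ₀) x + Ecomm n M κ ρ₀ R *ᵥ wvec κ (siteW n M ρ₀) x := by
  funext b
  rw [Pi.add_apply]
  simp only [wvec, Matrix.mulVec, dotProduct, Ecomm, Matrix.of_apply, siteW, bondW]
  rw [Finset.mul_sum, ← Finset.sum_add_distrib]
  refine Finset.sum_congr rfl fun e' _ => ?_
  have hc : ((Real.exp (κ * (ρ₀ b.1.1 - ρ₀ e'.1)) : ℝ) : ℂ) * ((Real.exp (κ * ρ₀ e'.1) : ℝ) : ℂ) = ((Real.exp (κ * ρ₀ b.1.1) : ℝ) : ℂ) := by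
    rw [← Complex.ofReal_mul, ← Real.exp_add]; ring_nf
  rw [Complex.ofReal_sub, Complex.ofReal_one]
  linear_combination (-(covGrad (fine n M) ((n : ℕ) : ℂ) R b e' * x e')) * hc

omit hM in
/-- `n·(e^{t} − 1) ≤ 2κ`-type bound: for `|t| ≤ κ/n`, `κ ≤ 1`, `n ≥ 1`: `|e^t − 1| ≤ 2κ/n`. [folklore] -/
theorem abs_exp_sub_one_le_of_small {t κ : ℝ} (hκ1 : κ ≤ 1) (ht : |t| ≤ κ / n) : |Real.exp t - 1| ≤ 2 * κ / n := by
  have hn1 : (1 : ℝ) ≤ n := by exact_mod_cast Nat.one_le_iff_ne_zero.mpr (NeZero.ne n)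
  have hn0 : (0 : ℝ) < n := by linarith
  have ht1 : |t| ≤ 1 := ht.trans ((div_le_one hn0).mpr (hκ1.trans hn1))
  calc |Real.exp t - 1| ≤ 2 * |t| := Real.abs_exp_sub_one_le ht1
    _ ≤ 2 * (κ / n) := by linarith
    _ = 2 * κ / n := by ring

/-- entries of the commutator: zero unless `e′ = (x + e_ν, ·)`, and then `≤ 2(1+α)κ` (for `0 ≤ κ ≤ 1`, `ρ₀` `1/n`-Lipschitz, `‖n(R−1)‖ ≤ α`).
[folklore] -/
theorem norm_Ecomm_apply_le {κ α : ℝ} (hκ0 : 0 ≤ κ) (hκ1 : κ ≤ 1) (hα : 0 ≤ α) {ρ₀ : Tor (fine n M) → ℝ}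
    (hlip : ∀ x ν, |ρ₀ (x + unitVec (fine n M) ν) - ρ₀ x| ≤ 1 / n) {R : Fin d → (Tor (fine n M) → Matrix o o ℂ)}
    (hR : ∀ μ x, ‖connS (fine n M) ((n : ℕ) : ℂ) R μ x‖ ≤ α) (b : (Tor (fine n M) × Fin d) × o) (e' : Tor (fine n M) × o) :
    ‖Ecomm n M κ ρ₀ R b e'‖ ≤ if e'.1 = b.1.1 + unitVec (fine n M) b.1.2 then 2 * (1 + α) * κ else 0 := by
  have hn0 : (0 : ℝ) < n := by exact_mod_cast Nat.pos_of_ne_zero (NeZero.ne n)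
  have hn1 : (1 : ℝ) ≤ n := by exact_mod_cast Nat.one_le_iff_ne_zero.mpr (NeZero.ne n)
  rw [Ecomm, Matrix.of_apply, covGrad_apply, norm_mul]
  by_cases h : e'.1 = b.1.1 + unitVec (fine n M) b.1.2
  · rw [if_pos h, if_pos h]
    -- the diagonal indicator vanishes on a genuine neighbour unless the shift is trivial; in that case the exponential factor vanishes
    by_cases hdiag : e' = (b.1.1, b.2)
    · -- then `x + e_ν = x`, the weight difference is `0` and the factor `e^0 − 1 = 0`
      have hx : e'.1 = b.1.1 := by rw [hdiag]
      rw [hx, sub_self, mul_zero, Real.exp_zero, sub_self, Complex.ofReal_zero, norm_zero, mul_zero]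
      positivity
    · rw [if_neg hdiag, sub_zero]
      have hRb : ‖R b.1.2 b.1.1‖ ≤ 1 + α / n := norm_R_le n M hR b.1.2 b.1.1
      have h1 : ‖((n : ℕ) : ℂ) * R b.1.2 b.1.1 b.2 e'.2‖ ≤ n + α := by
        rw [norm_mul, Complex.norm_natCast]
        calc (n : ℝ) * ‖R b.1.2 b.1.1 b.2 e'.2‖ ≤ n * (1 + α / n) :=
              mul_le_mul_of_nonneg_left ((norm_entry_le _ _ _).trans hRb) hn0.le
          _ = n + α := by field_simp
      have h2 : ‖(((Real.exp (κ * (ρ₀ b.1.1 - ρ₀ e'.1)) - 1 : ℝ) : ℂ))‖ ≤ 2 * κ / n := by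
        rw [Complex.norm_real, Real.norm_eq_abs]
        refine abs_exp_sub_one_le_of_small n hκ1 ?_
        rw [abs_mul, abs_of_nonneg hκ0]
        refine (mul_le_mul_of_nonneg_left ?_ hκ0).trans (by rw [mul_one_div])
        rw [h, abs_sub_comm]; exact hlip _ _
      calc ‖((n : ℕ) : ℂ) * R b.1.2 b.1.1 b.2 e'.2‖ * ‖(((Real.exp (κ * (ρ₀ b.1.1 - ρ₀ e'.1)) - 1 : ℝ) : ℂ))‖
          ≤ (n + α) * (2 * κ / n) := mul_le_mul h1 h2 (norm_nonneg _) (by positivity)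
        _ ≤ ((1 + α) * n) * (2 * κ / n) := by
            refine mul_le_mul_of_nonneg_right ?_ (by positivity)
            nlinarith
        _ = 2 * (1 + α) * κ := by field_simp
  · rw [if_neg h, if_neg h, zero_sub]
    by_cases hdiag : e' = (b.1.1, b.2)
    · have hx : e'.1 = b.1.1 := by rw [hdiag]
      rw [hx, sub_self, mul_zero, Real.exp_zero, sub_self, Complex.ofReal_zero, norm_zero, mul_zero]
    · rw [if_neg hdiag, neg_zero, mul_zero, norm_zero, zero_mul]

/-- **LEVEL-FREE SIZE OF THE COMMUTATOR**: `‖Ecomm‖ ≤ 2√d·card o·(1 + α)·κ` (Schur: rows have `card o` neighbour entries, columns `d·card o`).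
[folklore] -/
theorem opNorm_Ecomm_le {κ α : ℝ} (hκ0 : 0 ≤ κ) (hκ1 : κ ≤ 1) (hα : 0 ≤ α) (h2 : ∀ μ, 2 ≤ fine n M μ) {ρ₀ : Tor (fine n M) → ℝ}
    (hlip : ∀ x ν, |ρ₀ (x + unitVec (fine n M) ν) - ρ₀ x| ≤ 1 / n) {R : Fin d → (Tor (fine n M) → Matrix o o ℂ)}
    (hR : ∀ μ x, ‖connS (fine n M) ((n : ℕ) : ℂ) R μ x‖ ≤ α) :
    ‖Ecomm n M κ ρ₀ R‖ ≤ 2 * Real.sqrt d * Fintype.card o * (1 + α) * κ := by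
  set c : ℝ := 2 * (1 + α) * κ with hc
  have hc0 : 0 ≤ c := by positivity
  have hrow : ∀ b : (Tor (fine n M) × Fin d) × o, ∑ e', ‖Ecomm n M κ ρ₀ R b e'‖ ≤ Fintype.card o * c := by
    intro b
    calc ∑ e', ‖Ecomm n M κ ρ₀ R b e'‖
        ≤ ∑ e' : Tor (fine n M) × o, (if e'.1 = b.1.1 + unitVec (fine n M) b.1.2 then c else 0) :=
          Finset.sum_le_sum fun e' _ => norm_Ecomm_apply_le n M hκ0 hκ1 hα hlip hR b e'
      _ = Fintype.card o * c := by
          rw [Fintype.sum_prod_type, Finset.sum_eq_single (b.1.1 + unitVec (fine n M) b.1.2)]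
          · simp
          · intro x _ hx; simp [hx]
          · intro h; exact absurd (Finset.mem_univ _) h
  have hcol : ∀ e' : Tor (fine n M) × o, ∑ b, ‖Ecomm n M κ ρ₀ R b e'‖ ≤ d * (Fintype.card o * c) := by
    intro e'
    have hinj := Literature.MathematicalPhysics.QuantumFieldTheory.Balaban1983to89.Beta.TorusG0Decay.unitVec_injective (fine n M) h2
    calc ∑ b, ‖Ecomm n M κ ρ₀ R b e'‖
        ≤ ∑ b : (Tor (fine n M) × Fin d) × o, (if e'.1 = b.1.1 + unitVec (fine n M) b.1.2 then c else 0) :=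
          Finset.sum_le_sum fun b _ => norm_Ecomm_apply_le n M hκ0 hκ1 hα hlip hR b e'
      _ = ∑ p : Tor (fine n M) × Fin d, ∑ _α : o, (if e'.1 = p.1 + unitVec (fine n M) p.2 then c else 0) := Fintype.sum_prod_type _
      _ = ∑ p : Tor (fine n M) × Fin d, Fintype.card o * (if e'.1 = p.1 + unitVec (fine n M) p.2 then c else 0) := by
          simp only [Finset.sum_const, Finset.card_univ, nsmul_eq_mul]
      _ = Fintype.card o * ∑ ν : Fin d, ∑ x : Tor (fine n M), (if e'.1 = x + unitVec (fine n M) ν then c else 0) := by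
          rw [← Finset.mul_sum, Fintype.sum_prod_type, Finset.sum_comm]
      _ = Fintype.card o * ∑ _ν : Fin d, c := by
          congr 1
          refine Finset.sum_congr rfl fun ν _ => ?_
          rw [Finset.sum_eq_single (e'.1 - unitVec (fine n M) ν)]
          · simp
          · intro x _ hx
            rw [if_neg]; intro h'; exact hx (by rw [h', add_sub_cancel_right])
          · intro h; exact absurd (Finset.mem_univ _) h
      _ = d * (Fintype.card o * c) := by rw [Finset.sum_const, Finset.card_univ, Fintype.card_fin, nsmul_eq_mul]; ring
  calc ‖Ecomm n M κ ρ₀ R‖ ≤ Real.sqrt ((Fintype.card o * c) * (d * (Fintype.card o * c))) :=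
        opNorm_le_sqrt_of_schur _ (by positivity) (by positivity) hrow hcol
    _ = 2 * Real.sqrt d * Fintype.card o * (1 + α) * κ := by
        rw [show (Fintype.card o * c) * (d * (Fintype.card o * c)) = (d : ℝ) * (Fintype.card o * c) ^ 2 by ring,
          Real.sqrt_mul (Nat.cast_nonneg _), Real.sqrt_sq (by positivity), hc]
        ring

end Gradient

end Summit.QuantumFields.BalabanUV.T4Continuum.ScalarCovariantGradComm

end
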